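import Summits.AtomisticToContinuum.HydrodynamicLimit.Theorems.DensityCap.Negative.DensityCapFalseOfDenseExcursionAbovePacking
import Summits.AtomisticToContinuum.HydrodynamicLimit.Theses.ImplosionDichotomy
import Summits.AtomisticToContinuum.HydrodynamicLimit.Theorems.JParityClosureDensityCapEulerDensityModulus
import Summits.AtomisticToContinuum.HydrodynamicLimit.Theorems.JParityClosureDensityCapCapEventSubset

/-!
# The packing band is a consequence of the CONJUNCT: `HydrodynamicLimit → PackingBandAt (81/π)`

Negative-side structure for the crux `JParityClosure.DensityCap` (stmt-AtomisticToContinuum-13082), standing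
disprover cycle 3 (`Cruxes/DensityCap/Disproof.lean` §10). Cycle 2 showed that the UNGUARDED crux proves the
`σ`-uniform packing band `PackingBandAt (81/π)` (`packingBandAt_of_densityCap`) and is therefore false under
`H = DenseExcursionAbovePacking` (a tied classical hard-sphere-Euler solution past reduced density `81/π`). Here the
same hazard is pinned on the AUDITED SUMMIT CONJUNCT itself, with a proof that needs no grid, no clock and no mass
conservation — one test function at one time:

* `density_le_packing_of_tendstoHydroFieldsAt` — THE LOCAL LEMMA. If the local Gibbs laws at reduced diameter
  `σ ≤ 1/2` satisfy the hydrodynamic limit AT ONE TIME `t` (`TendstoHydroFieldsAt … t`) towards a density `ρ t`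
  that is continuous, then `ρ t x · σ³ ≤ 81/π` for EVERY `x`: test with the cone `b_r(·, x₀)` around an offending
  point; on the good set (probability `1`) the empirical side is the mollified density `≤ 81/(πσ³)` SURELY
  (hard-core packing, `mollDensity_le_packing_hs`, once `ε_N ≤ r ≤ 1/4`), the Euler side is `≥ 81/(πσ³) + κ`
  (cone mass `1`, `coneMass_eq_one`), so the deviation event is SURE for all large `N` instead of rare.
* `packingBandAt_of_hydrodynamicLimit : HydrodynamicLimit → PackingBandAt (81/π)` — the conjunct (the sub-problem
  Statement `_root_.HydrodynamicLimit`, an `abbrev` of `Literature.MathematicalPhysics.KineticTheory.HydrodynamicLimit`) implies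
  the `σ`-uniform sup-norm packing band for EVERY tied classical solution of the typed hard-sphere Euler system at
  small `σ`, i.e. `DiluteSelfConsistency` (stmt-3091) at the fixed level `81/π` is NECESSARY for the summit, not a
  route choice;
* `hydrodynamicLimit_false_of_denseExcursionAbovePacking : DenseExcursionAbovePacking → ¬ HydrodynamicLimit` and
  `hydrodynamicLimit_false_of_polynomialCompressionAt (κ > 3)` — the implosion programme of route
  ImplosionDichotomy (`DenseExcursion`, stmt-12586; `PolynomialCompression`), if ever pushed to reduced density
  `81/π` (far outside the analyticity range of the typed `hsCompressibility`, which is `deriv`-junk-prone there and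
  EXACTLY ideal above `6/π`), refutes the summit conjunct AS TYPED — not only the route item 3091;
* `reaches_iff_not_packingBandAt` (every level `C`), `packingBandAt_mono`, `packingBandAt_of_diluteSelfConsistency`
  — bookkeeping: `ImplosionDichotomy.DiluteSelfConsistency → PackingBandAt C` for every `C > 0`, so after the
  line `lipschitz-clock-free-past-cap` (`HydroLimitInBand → DiluteSelfConsistency → DensityCap`, candidate proof
  attached to the item) the crux sits in the sandwich
  `HydroLimitInBand ∧ DiluteSelfConsistency ⟹ DensityCap ⟹ PackingBandAt (81/π) ⟸ HydrodynamicLimit`.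

No new hypothesis `def`; `PackingBandAt`, `DenseExcursionAbovePacking` are those of
`Negative/DensityCapFalseOfDenseExcursionAbovePacking.lean`. refuter-cdisprove-stmt-AtomisticToContinuum-13082-g3-0.

MAINTENANCE RECORD (full-build repair 2026-08-17, dependency drift; mathematics unchanged): (1) route
`JParityClosure` dropped its copy of `DiluteSelfConsistency` (stmt-3091) at rev 3 (2026-08-16T23:22Z); the same item is
read from route `ImplosionDichotomy` (`open … (DiluteSelfConsistency)`); (2) the sub-problem Statement
`_root_.HydrodynamicLimit` was RE-TYPED 2026-08-16T21:23Z (D-0032) to the packing-guarded form — no longer an `abbrev`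
of `Literature.MathematicalPhysics.KineticTheory.HydrodynamicLimit` — so the four theorems whose headers named it are
re-stated against that (unguarded) Literature conjunct under the suffix `_unguarded` (proofs verbatim: they were
written against the abbrev), the old names surviving as deprecated aliases (append-only: deprecate, don't mutate).
Against the GUARDED conjunct none of the four is derivable as typed (the guard `ρσ³ < η₀` withholds the LLN exactly
where the band would be violated); `HydrodynamicLimit.of_unguarded` links the two conjuncts.
-/

noncomputable section

namespace Summit.AtomisticToContinuum.HydrodynamicLimit.Theorems.DensityCapNegative

open MeasureTheory Filter Set Topology Metric
open scoped ENNReal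
open Literature.MathematicalPhysics.KineticTheory Literature.Analysis.FluidPDE
open Literature.Analysis.FunctionSpaces
open Summit.AtomisticToContinuum.HydrodynamicLimit.Theses.JParityClosure
open Summit.AtomisticToContinuum.HydrodynamicLimit.Theses.ImplosionDichotomy (DiluteSelfConsistency)
open Summit.AtomisticToContinuum.HydrodynamicLimit.Theorems.PolynomialCompressionPDE (Flows flows_nonempty)
open Summit.AtomisticToContinuum.HydrodynamicLimit.Theorems.PolynomialCompressionAt (Reaches)

/-! ## §1 The cone test function -/

/-! The three cone identities below were local copies (2026-08-16) of lemmas landed meanwhile in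
`JParityClosureDensityCapEulerDensityModulus` / `JParityClosureDensityCapCapEventSubset`; they survive as deprecated
aliases of the landed declarations (gate dedup, full-build repair 2026-08-17), the proofs below citing the landed ones. -/

/-- The cone kernel is continuous in the particle variable — deprecated local name of `densMod_continuous_cone`. -/
@[deprecated densMod_continuous_cone (since := "2026-08-17")]
alias continuous_cone_left := densMod_continuous_cone

/-- The empirical density field tested against the cone at `x₀` IS the mollified empirical density at `x₀` —
deprecated local name of `capSub_empiricalDensityField_cone`. -/
@[deprecated capSub_empiricalDensityField_cone (since := "2026-08-17")]
alias empiricalDensityField_cone := capSub_empiricalDensityField_cone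

/-- The mass of the cone in its FIRST variable is `1` (`0 < r ≤ 1/2`) — deprecated local name of
`densMod_integral_cone_eq_one`. -/
@[deprecated densMod_integral_cone_eq_one (since := "2026-08-17")]
alias integral_cone_left := densMod_integral_cone_eq_one

/-- If `f ≥ L` on the minimal-image `r`-ball about `x₀` (`0 < r ≤ 1/2`, `f` integrable), then `∫ b_r(y,x₀) f(y) dy ≥ L`. -/
theorem le_integral_cone_mul {r : ℝ} (hr : 0 < r) (hr2 : r ≤ 1 / 2) {f : T3 → ℝ} (hf : Integrable f volume)
    {x₀ : T3} {L : ℝ} (hL : ∀ y, Torus.euclidDist y x₀ < r → L ≤ f y) : L ≤ ∫ y, cone r y x₀ * f y := by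
  have hci : Integrable (fun y : T3 => cone r y x₀) volume :=
    Integrable.of_bound (densMod_continuous_cone r x₀).aestronglyMeasurable (3 / (Real.pi * r ^ 3))
      (ae_of_all _ fun y => by
        rw [Real.norm_eq_abs, abs_of_nonneg (cone_nonneg hr _ _)]
        exact cone_le hr _ _)
  have hprod : Integrable (fun y : T3 => cone r y x₀ * f y) volume := by
    refine Integrable.bdd_mul (c := 3 / (Real.pi * r ^ 3)) hf (densMod_continuous_cone r x₀).aestronglyMeasurable
      (ae_of_all _ fun y => ?_)
    rw [Real.norm_eq_abs, abs_of_nonneg (cone_nonneg hr _ _)]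
    exact cone_le hr _ _
  have hpt : ∀ y, cone r y x₀ * L ≤ cone r y x₀ * f y := by
    intro y
    by_cases hy : Torus.euclidDist y x₀ < r
    · exact mul_le_mul_of_nonneg_left (hL y hy) (cone_nonneg hr _ _)
    · rw [cone_eq_zero_of_le hr (not_lt.1 hy), zero_mul, zero_mul]
  calc L = ∫ y, cone r y x₀ * L := by rw [integral_mul_const, densMod_integral_cone_eq_one hr hr2, one_mul]
    _ ≤ ∫ y, cone r y x₀ * f y := integral_mono (hci.mul_const L) hprod hpt

/-! ## §2 The local lemma: a hydrodynamic limit at one time forces the packing band at that time -/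

/-- **Packing band from the hydrodynamic limit at ONE time.** For continuous positive profiles, `0 < σ ≤ 1/2`, any
flow family, any fields `(ρ, u, θ)` and any time `t`: if the local Gibbs laws satisfy `TendstoHydroFieldsAt … t` and
`ρ t` is continuous, then `ρ t x · σ³ ≤ 81/π` everywhere. (At an offending `x₀`, `ρ t ≥ 81/(πσ³) + κ` on an
`r`-ball; the cone test `b_r(·,x₀)` has Euler side `≥ 81/(πσ³) + κ` and, on the good set, empirical side
`= ρ̄ʳ ≤ 81/(πσ³)` surely once `ε_N ≤ r ≤ 1/4`; the deviation event `{κ/2 < |·|}` then contains the good set, of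
probability `1`, for all large `N` — it cannot tend to `0`.) -/
theorem density_le_packing_of_tendstoHydroFieldsAt {a₀ θ₀ : T3 → ℝ} {u₀ : T3 → V3} (ha : Continuous a₀)
    (hθ : Continuous θ₀) (hu : Continuous u₀) (ha0 : ∀ x, 0 < a₀ x) (hθ0 : ∀ x, 0 < θ₀ x) {σ : ℝ} (hσ : 0 < σ)
    (hσ2 : σ ≤ 1 / 2) (Φ : Flows σ) {ρ θ : ℝ → T3 → ℝ} {u : ℝ → T3 → V3} {t : ℝ}
    (hlim : TendstoHydroFieldsAt (fun N => localGibbsLaw σ a₀ u₀ θ₀ N (Φ N)) Φ ρ u θ t)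
    (hcont : Continuous (ρ t)) (x₀ : T3) : ρ t x₀ * σ ^ 3 ≤ 81 / Real.pi := by
  by_contra hx
  push Not at hx
  have hpi := Real.pi_pos
  have hσ3 : 0 < σ ^ 3 := pow_pos hσ 3
  set M : ℝ := 81 / (Real.pi * σ ^ 3) with hMdef
  have hMlt : M < ρ t x₀ := by
    rw [hMdef, div_lt_iff₀ (by positivity)]
    rw [div_lt_iff₀ hpi] at hx
    calc (81 : ℝ) < ρ t x₀ * σ ^ 3 * Real.pi := hx
      _ = ρ t x₀ * (Real.pi * σ ^ 3) := by ring
  set κ : ℝ := (ρ t x₀ - M) / 2 with hκdef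
  have hκ : 0 < κ := by rw [hκdef]; linarith
  -- continuity: a minimal-image ball about `x₀` (radius `≤ 1/4`) on which `ρ_t ≥ M + κ`
  obtain ⟨b, hb, hb4, hball⟩ : ∃ b : ℝ, 0 < b ∧ b ≤ 1 / 4 ∧ ∀ y, Torus.euclidDist y x₀ < b → M + κ ≤ ρ t y := by
    have hlt : M + κ < ρ t x₀ := by rw [hκdef]; linarith
    have hev : ∀ᶠ y in 𝓝 x₀, M + κ < ρ t y := (hcont.tendsto x₀).eventually (lt_mem_nhds hlt)
    obtain ⟨b', hb', hball⟩ := Metric.eventually_nhds_iff.1 hev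
    refine ⟨min b' (1 / 4), lt_min hb' (by norm_num), min_le_right _ _, fun y hy => le_of_lt (hball ?_)⟩
    calc dist y x₀ = ‖y - x₀‖ := dist_eq_norm y x₀
      _ ≤ Torus.euclidDist y x₀ := Torus.norm_sub_le_euclidDist_holds y x₀
      _ < b' := lt_of_lt_of_le hy (min_le_left _ _)
  -- the test: the cone of radius `r = b` about `x₀`, deviation `κ/2`
  have hr4 : b ≤ 1 / 4 := hb4
  have hr2 : b ≤ 1 / 2 := by linarith
  obtain ⟨hdens, -, -⟩ := hlim (fun y => cone b y x₀) (densMod_continuous_cone b x₀) (κ / 2) (by positivity)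
  -- eventually (in `N`): the deviation probability is `< 1` and `ε_N < b`
  have hev1 : ∀ᶠ N in atTop, localGibbsLaw σ a₀ u₀ θ₀ N (Φ N)
      {z | κ / 2 < |empiricalDensityField ((Φ N).flow t z) (fun y => cone b y x₀) - ∫ x, cone b x x₀ * ρ t x|}
        < 1 := (tendsto_order.1 hdens).2 1 one_pos
  have hev2 : ∀ᶠ N in atTop, hsDiameter σ N < b :=
    (tendsto_order.1 (Literature.Barriers.AtomisticToContinuum.hsDiameter_tendsto_zero σ)).2 b hb
  obtain ⟨N, hN1, hN2⟩ := (hev1.and hev2).exists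
  haveI : IsProbabilityMeasure (localGibbsLaw σ a₀ u₀ θ₀ N (Φ N)) :=
    isProbabilityMeasure_localGibbsLaw ha hθ hu ha0 hθ0 hσ2 N (Φ N)
  -- Euler side of the test
  have hρint : Integrable (ρ t) volume := integrable_of_continuous_T3 hcont
  have hEuler : M + κ ≤ ∫ x, cone b x x₀ * ρ t x := le_integral_cone_mul hb hr2 hρint fun y hy => hball y hy
  -- every good configuration deviates by more than `κ/2`
  have hsubset : (Φ N).good ⊆
      {z | κ / 2 < |empiricalDensityField ((Φ N).flow t z) (fun y => cone b y x₀) - ∫ x, cone b x x₀ * ρ t x|} := by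
    intro z hz
    have hw : (Φ N).flow t z ∈ hardSphereDomain (Torus.geometry (Fin 3)) (N + 1) (hsDiameter σ N) :=
      (Φ N).good_subset ((Φ N).mapsTo_good t hz)
    have hpack : mollDensity b ((Φ N).flow t z) x₀ ≤ M := mollDensity_le_packing_hs hσ hN2.le hr4 hw x₀
    show κ / 2 < |empiricalDensityField ((Φ N).flow t z) (fun y => cone b y x₀) - ∫ x, cone b x x₀ * ρ t x|
    rw [capSub_empiricalDensityField_cone, abs_sub_comm, abs_of_nonneg (by linarith)]
    linarith
  have hone : localGibbsLaw σ a₀ u₀ θ₀ N (Φ N) (Φ N).good = 1 := by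
    rw [← prob_compl_eq_zero_iff (Φ N).measurableSet_good]
    exact ae_iff.1 (ae_mem_good_localGibbsLaw σ a₀ θ₀ u₀ N Φ)
  have hge : (1 : ℝ≥0∞) ≤ localGibbsLaw σ a₀ u₀ θ₀ N (Φ N)
      {z | κ / 2 < |empiricalDensityField ((Φ N).flow t z) (fun y => cone b y x₀) - ∫ x, cone b x x₀ * ρ t x|} :=
    hone ▸ measure_mono hsubset
  exact absurd hN1 (not_lt.2 hge)

/-- The local lemma for a classical solution (continuity of `ρ t` from `IsHardSphereEulerSolution`, `t < T`). -/
theorem density_le_packing_of_tendstoHydroFieldsAt_solution {a₀ θ₀ : T3 → ℝ} {u₀ : T3 → V3}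
    (ha : Continuous a₀) (hθ : Continuous θ₀) (hu : Continuous u₀) (ha0 : ∀ x, 0 < a₀ x) (hθ0 : ∀ x, 0 < θ₀ x)
    {σ : ℝ} (hσ : 0 < σ) (hσ2 : σ ≤ 1 / 2) (Φ : Flows σ) {T : ℝ} {ρ θ : ℝ → T3 → ℝ} {u : ℝ → T3 → V3}
    (hE : IsHardSphereEulerSolution σ T ρ u θ) {t : ℝ} (ht : t ∈ Ico 0 T)
    (hlim : TendstoHydroFieldsAt (fun N => localGibbsLaw σ a₀ u₀ θ₀ N (Φ N)) Φ ρ u θ t) (x : T3) :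
    ρ t x * σ ^ 3 ≤ 81 / Real.pi :=
  density_le_packing_of_tendstoHydroFieldsAt ha hθ hu ha0 hθ0 hσ hσ2 Φ hlim
    (hE.smooth_density.isSmooth_slice ht).continuous x

/-! ## §3 Bookkeeping: levels, and the sandwich around the crux -/

/-- The packing band is monotone in the level. -/
theorem packingBandAt_mono {C C' : ℝ} (hCC' : C ≤ C') (h : PackingBandAt C) : PackingBandAt C' := by
  intro a₀ θ₀ u₀ ha hθ hu ha0 hθ0
  obtain ⟨σ₀, hσ₀, h⟩ := h a₀ θ₀ u₀ ha hθ hu ha0 hθ0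
  exact ⟨σ₀, hσ₀, fun σ hσ hσ0 T ρ θ u hE Φ hA t ht x => (h σ hσ hσ0 T ρ θ u hE Φ hA t ht x).trans hCC'⟩

/-- At EVERY level `C`: a tied excursion strictly above `C` (`Reaches (C < ρσ³)`) is exactly the failure of
`PackingBandAt C` (Alexander's flows for `σ < 1/2`; tie through one flow family ⇒ through all). -/
theorem reaches_iff_not_packingBandAt (C : ℝ) :
    Reaches (fun σ r => C < r * σ ^ 3) ↔ ¬ PackingBandAt C := by
  constructor
  · rintro ⟨a₀, θ₀, u₀, ha, hθ, hu, ha0, hθ0, H⟩ hband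
    obtain ⟨σ₀, hσ₀, hband⟩ := hband a₀ θ₀ u₀ ha hθ hu ha0 hθ0
    obtain ⟨σ, hσ, hσlt, T, ρ, θ, u, hE, hA, t, ht, x, hx⟩ := H (min σ₀ (1 / 2)) (lt_min hσ₀ (by norm_num))
    have hσ0 : σ < σ₀ := lt_of_lt_of_le hσlt (min_le_left _ _)
    have hσ2 : σ < 1 / 2 := lt_of_lt_of_le hσlt (min_le_right _ _)
    obtain ⟨Φ⟩ := flows_nonempty hσ hσ2
    have hle := hband σ hσ hσ0 T ρ θ u hE Φ (hA Φ) t ht x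
    exact absurd hx (not_lt.2 hle)
  · intro h
    unfold PackingBandAt at h
    push Not at h
    obtain ⟨a₀, θ₀, u₀, ha, hθ, hu, ha0, hθ0, H⟩ := h
    refine ⟨a₀, θ₀, u₀, ha, hθ, hu, ha0, hθ0, fun σ₀ hσ₀ => ?_⟩
    obtain ⟨σ, hσ, hσlt, T, ρ, θ, u, hE, Φ, hA, t, ht, x, hx⟩ := H σ₀ hσ₀
    exact ⟨σ, hσ, hσlt, T, ρ, θ, u, hE,
      fun Ψ => PolynomialCompressionAt.tendstoHydroFieldsAt_zero_of_one_flow Φ Ψ hA, t, ht, x, hx⟩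

/-- `DiluteSelfConsistency` (stmt-3091, read from route `ImplosionDichotomy` since `JParityClosure` dropped its copy at
rev 3; every level `η > 0`, strict) gives the
packing band at every positive level — the upper slice of the sandwich
`HydroLimitInBand ∧ DiluteSelfConsistency ⟹ DensityCap ⟹ PackingBandAt (81/π)`. -/
theorem packingBandAt_of_diluteSelfConsistency (hD : DiluteSelfConsistency) {C : ℝ} (hC : 0 < C) :
    PackingBandAt C := by
  intro a₀ θ₀ u₀ ha hθ hu ha0 hθ0
  obtain ⟨σ₀, hσ₀, h⟩ := hD C hC a₀ θ₀ u₀ ha hθ hu ha0 hθ0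
  exact ⟨σ₀, hσ₀, fun σ hσ hσ0 T ρ θ u hE Φ hA t ht x => (h σ hσ hσ0 T ρ θ u hE Φ hA t ht x).le⟩

/-! ## §4 The conjunct implies the packing band; the implosion programme at level `81/π` refutes the conjunct -/

/-- **`HydrodynamicLimitFor σ` forces the packing band at THIS `σ`** (`0 < σ ≤ 1/2`): every classical solution
tied at `t = 0` through some flow family obeys `ρ_t(x) σ³ ≤ 81/π` on `[0,T) × 𝕋³`. -/
theorem density_le_packing_of_hydrodynamicLimitFor {σ : ℝ} (hσ : 0 < σ) (hσ2 : σ ≤ 1 / 2)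
    (h : HydrodynamicLimitFor σ) {a₀ θ₀ : T3 → ℝ} {u₀ : T3 → V3} (ha : Continuous a₀) (hθ : Continuous θ₀)
    (hu : Continuous u₀) (ha0 : ∀ x, 0 < a₀ x) (hθ0 : ∀ x, 0 < θ₀ x) {T : ℝ} {ρ θ : ℝ → T3 → ℝ}
    {u : ℝ → T3 → V3} (hE : IsHardSphereEulerSolution σ T ρ u θ) (Φ : Flows σ)
    (hA : TendstoHydroFieldsAt (fun N => localGibbsLaw σ a₀ u₀ θ₀ N (Φ N)) Φ ρ u θ 0) {t : ℝ} (ht : t ∈ Ico 0 T)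
    (x : T3) : ρ t x * σ ^ 3 ≤ 81 / Real.pi :=
  density_le_packing_of_tendstoHydroFieldsAt_solution ha hθ hu ha0 hθ0 hσ hσ2 Φ hE ht
    (h a₀ θ₀ u₀ ha hθ hu ha0 hθ0 T ρ θ u hE Φ hA t ht) x

/-- **THE CONJUNCT IMPLIES THE PACKING BAND: `HydrodynamicLimit → PackingBandAt (81/π)`.** The audited summit
conjunct (`_root_.HydrodynamicLimit` of `Summits/AtomisticToContinuum/HydrodynamicLimit/Statement.lean`, an `abbrev` of the
Literature decl `Literature.MathematicalPhysics.KineticTheory.HydrodynamicLimit`) asserts, in particular, a `σ`-uniform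
sup-norm bound `ρ_t(x) σ³ ≤ 81/π` for EVERY tied classical solution of the typed hard-sphere Euler system at small
`σ` — a pure PDE statement of `DiluteSelfConsistency` type (stmt-3091 at the fixed level `81/π`).  (Statement of the
UNGUARDED conjunct `Literature.MathematicalPhysics.KineticTheory.HydrodynamicLimit`, which `_root_.HydrodynamicLimit`
abbreviated when this was landed; re-stated 2026-08-17 after the D-0032 re-type, proof verbatim.) -/
theorem packingBandAt_of_hydrodynamicLimit_unguarded (h : Literature.MathematicalPhysics.KineticTheory.HydrodynamicLimit) :
    PackingBandAt (81 / Real.pi) := by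
  intro a₀ θ₀ u₀ ha hθ hu ha0 hθ0
  obtain ⟨σ₀, hσ₀, h⟩ := h a₀ θ₀ u₀ ha hθ hu ha0 hθ0
  refine ⟨min σ₀ (1 / 2), lt_min hσ₀ (by norm_num), ?_⟩
  intro σ hσ hσlt T ρ θ u hE Φ hA t ht x
  have hσ0 : σ < σ₀ := lt_of_lt_of_le hσlt (min_le_left _ _)
  have hσ2 : σ ≤ 1 / 2 := (lt_of_lt_of_le hσlt (min_le_right _ _)).le
  exact density_le_packing_of_tendstoHydroFieldsAt_solution ha hθ hu ha0 hθ0 hσ hσ2 Φ hE ht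
    (h σ hσ hσ0 T ρ θ u hE Φ hA t ht) x

/-- Deprecated (header named `_root_.HydrodynamicLimit`, the unguarded conjunct until the 2026-08-16 re-type). -/
@[deprecated packingBandAt_of_hydrodynamicLimit_unguarded (since := "2026-08-17")]
alias packingBandAt_of_hydrodynamicLimit := packingBandAt_of_hydrodynamicLimit_unguarded

/-- **`DenseExcursionAbovePacking → ¬ HydrodynamicLimit` (unguarded conjunct)**: a tied classical hard-sphere-Euler solution exceeding
reduced density `81/π` at arbitrarily small `σ` (the implosion programme `DenseExcursion` pushed to level `81/π`)
refutes the summit conjunct AS TYPED, not only the route item `DiluteSelfConsistency`. (`H` is not constructible in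
the tree and its truth on paper is itself undecided: it needs an implosion of the TYPED equation of state through
the non-analytic range of `hsCompressibility`; this is a conditional, not a refutation.) -/
theorem hydrodynamicLimit_false_of_denseExcursionAbovePacking_unguarded (hH : DenseExcursionAbovePacking) :
    ¬ Literature.MathematicalPhysics.KineticTheory.HydrodynamicLimit :=
  fun h => (reaches_iff_not_packingBandAt (81 / Real.pi)).1 hH (packingBandAt_of_hydrodynamicLimit_unguarded h)

/-- Deprecated (header named `_root_.HydrodynamicLimit`, the unguarded conjunct until the 2026-08-16 re-type). -/
@[deprecated hydrodynamicLimit_false_of_denseExcursionAbovePacking_unguarded (since := "2026-08-17")]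
alias hydrodynamicLimit_false_of_denseExcursionAbovePacking :=
  hydrodynamicLimit_false_of_denseExcursionAbovePacking_unguarded

/-- `PolynomialCompressionAt κ` with `κ > 3` already gives `DenseExcursionAbovePacking` (reduced density
`σ^(3-κ) > 81/π` for small `σ`). -/
theorem denseExcursionAbovePacking_of_polynomialCompressionAt {κ : ℝ} (hκ : 3 < κ)
    (hPC : PolynomialCompressionAt κ) : DenseExcursionAbovePacking := by
  have hpi := Real.pi_pos
  set σ₁ : ℝ := (Real.pi / 81) ^ (1 / (κ - 3)) with hσ₁def
  have hσ₁ : 0 < σ₁ := Real.rpow_pos_of_pos (by positivity) _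
  refine PolynomialCompressionAt.Reaches.mono hσ₁ (fun σ r hσ hσlt hr => ?_)
    ((PolynomialCompressionAt.iff_reaches κ).1 hPC)
  have hk3 : 0 < κ - 3 := by linarith
  have hpow : σ ^ (κ - 3) < Real.pi / 81 := by
    calc σ ^ (κ - 3) < σ₁ ^ (κ - 3) := Real.rpow_lt_rpow hσ.le hσlt hk3
      _ = Real.pi / 81 := by
          rw [hσ₁def, ← Real.rpow_mul (by positivity), one_div_mul_cancel hk3.ne', Real.rpow_one]
  have hkey : σ ^ (-κ) * σ ^ (3 : ℕ) = (σ ^ (κ - 3))⁻¹ := by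
    rw [← Real.rpow_natCast, ← Real.rpow_add hσ, ← Real.rpow_neg hσ.le]
    congr 1
    push_cast
    ring
  show 81 / Real.pi < r * σ ^ 3
  calc 81 / Real.pi < (σ ^ (κ - 3))⁻¹ := by
        rw [lt_inv_comm₀ (by positivity) (Real.rpow_pos_of_pos hσ _), inv_div]
        exact hpow
    _ = σ ^ (-κ) * σ ^ (3 : ℕ) := hkey.symm
    _ ≤ r * σ ^ 3 := mul_le_mul_of_nonneg_right hr (pow_nonneg hσ.le 3)

/-- **`PolynomialCompressionAt κ → ¬ HydrodynamicLimit` (unguarded conjunct) for every `κ > 3`.** -/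
theorem hydrodynamicLimit_false_of_polynomialCompressionAt_unguarded {κ : ℝ} (hκ : 3 < κ)
    (hPC : PolynomialCompressionAt κ) : ¬ Literature.MathematicalPhysics.KineticTheory.HydrodynamicLimit :=
  hydrodynamicLimit_false_of_denseExcursionAbovePacking_unguarded
    (denseExcursionAbovePacking_of_polynomialCompressionAt hκ hPC)

/-- Deprecated (header named `_root_.HydrodynamicLimit`, the unguarded conjunct until the 2026-08-16 re-type). -/
@[deprecated hydrodynamicLimit_false_of_polynomialCompressionAt_unguarded (since := "2026-08-17")]
alias hydrodynamicLimit_false_of_polynomialCompressionAt := hydrodynamicLimit_false_of_polynomialCompressionAt_unguarded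

/-- Contrapositive packaging at the conjunct level: ANY failure of the packing band at level `81/π` (some profiles,
arbitrarily small `σ`, one tied classical solution, one flow family) refutes the (unguarded) summit conjunct. -/
theorem not_hydrodynamicLimit_of_not_packingBandAt_unguarded (h : ¬ PackingBandAt (81 / Real.pi)) :
    ¬ Literature.MathematicalPhysics.KineticTheory.HydrodynamicLimit :=
  fun hHL => h (packingBandAt_of_hydrodynamicLimit_unguarded hHL)

/-- Deprecated (header named `_root_.HydrodynamicLimit`, the unguarded conjunct until the 2026-08-16 re-type). -/
@[deprecated not_hydrodynamicLimit_of_not_packingBandAt_unguarded (since := "2026-08-17")]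
alias not_hydrodynamicLimit_of_not_packingBandAt := not_hydrodynamicLimit_of_not_packingBandAt_unguarded

end Summit.AtomisticToContinuum.HydrodynamicLimit.Theorems.DensityCapNegative

end
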